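import Summits.ValiantsHypothesis.ValiantsHypothesis.Theorems.DepthWindowTreeBiasBridge

/-!
# Route `DepthWindow` — tree bias, first rung: depth `1` (anti-vacuity check of `TreeBiasGe`)

Cone-free helper (decomp-valiant lens 4, g12) supporting the crux item `HomImmHardTwoOne`
(stmt-ValiantsHypothesis-30635): the depth-`1` case of the typed tree bias of
`DepthWindowTreeBiasBridge.lean` is computed in closed form — the only depth-`1` `W`-tree is the star, its
only internal path is the root, and its bias is `‖W‖₁ - |Sum W|` (LST 2022, discussion after Def. 2).  Hence
`TreeBiasGe w 1 τ ↔ τ ≤ ∑ |wᵢ| - |∑ wᵢ|` for `d ≥ 1`: the predicate is neither vacuous nor trivial, and the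
`Δ ≤ 1` instances of `TreeBiasGrowth` reduce to exhibiting fitting words of large `ℓ¹`-mass.

References: [LimayeSrinivasanTavenas2022] CCC 2022, LIPIcs 234:32, Def. 2.
-/

-- layout Summits/ValiantsHypothesis/ValiantsHypothesis forces the duplicated namespace component
set_option linter.dupNamespace false

namespace Summit.ValiantsHypothesis.ValiantsHypothesis.Theorems.DepthWindow.TreeBias

open Finset

variable {d : ℕ}

/-- At level `0` every block is a singleton: `Sum({l}) = w l`. [cite: LimayeSrinivasanTavenas2022, Def. 2] -/
theorem blockSum_zero (w : Fin d → ℤ) (T : LTree d) (l : Fin d) : blockSum w T 0 l = w l := by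
  unfold blockSum
  have h : (univ.filter fun j => T.lab 0 j = l) = {l} := by
    ext j
    simp [T.leaf j]
  rw [h, sum_singleton]

/-- The off-path cost of the root path in a depth-`1` tree (the star) is `‖W‖₁ = ∑ |wᵢ|`.
[cite: LimayeSrinivasanTavenas2022, Def. 2] -/
theorem offCost_one (w : Fin d → ℤ) (T : LTree d) (hroot : ∀ i j, T.lab 1 i = T.lab 1 j) (i : Fin d) :
    offCost w T 1 1 i = ∑ j, |w j| := by
  unfold offCost
  rw [Icc_self, sum_singleton]
  have h1 : (univ.filter fun j => T.lab 1 j = T.lab 1 i) = univ := by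
    ext j
    simp [hroot j i]
  have h0 : T.lab (1 - 1) = id := funext fun j => by simpa using T.leaf j
  rw [h1, h0, image_id]
  have h2 : (univ : Finset (Fin d)).filter (fun l => 1 = 1 ∨ l ≠ id i) = univ := by
    ext l
    simp
  rw [h2]
  refine sum_congr rfl fun l _ => ?_
  rw [show blockSum w T (1 - 1) l = blockSum w T 0 l from rfl, blockSum_zero]

/-- **Depth-`1` tree bias in closed form**: for `d ≥ 1`, `Treebias₁(W) ≥ τ ↔ τ ≤ ‖W‖₁ - |Sum W|`.
[cite: LimayeSrinivasanTavenas2022, Def. 2] -/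
theorem treeBiasGe_one_iff (hd : 0 < d) (w : Fin d → ℤ) (τ : ℕ) :
    TreeBiasGe w 1 τ ↔ (τ : ℤ) ≤ ∑ j, |w j| - |∑ j, w j| := by
  constructor
  · intro h
    -- the star tree
    let T : LTree d := ⟨fun t i => if t = 0 then i else ⟨0, hd⟩, fun i => by simp, fun t i j _ => by simp⟩
    obtain ⟨t, i, ht1, ht, hτ⟩ := h T (fun i j => by simp [T])
    obtain rfl : t = 1 := le_antisymm ht ht1
    rwa [offCost_one w T (fun i j => by simp [T]) i] at hτ
  · intro h T hroot
    refine ⟨1, ⟨0, hd⟩, le_rfl, le_rfl, ?_⟩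
    rwa [offCost_one w T hroot]

/-- The two-letter word `(+k, -k)`: depth-`1` tree bias exactly `2k` bits (so `TreeBiasGe` is not vacuous and
grows with the letter scale). [folklore] -/
theorem treeBiasGe_one_pair (k : ℕ) : TreeBiasGe (d := 2) ![(k : ℤ), -(k : ℤ)] 1 (2 * k) := by
  rw [treeBiasGe_one_iff (by norm_num)]
  simp [Fin.sum_univ_two]
  omega

end Summit.ValiantsHypothesis.ValiantsHypothesis.Theorems.DepthWindow.TreeBias
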